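import Literature.Analysis.FluidPDE.ElgindiAngularCorrectorWords
import Literature.Analysis.FluidPDE.ElgindiProfileDefectRadial
import Literature.Analysis.FluidPDE.ElgindiL12HkBound
import Literature.Analysis.FluidPDE.ElgindiHkDensity
import Literature.Analysis.FluidPDE.ElgindiNonlocalDerivatives
import HarnessLib

/-!
# The defect datum of the approximate stream function of `Φ_*`: an `O(α²)` element of the
`𝓗⁴`-closure class, orthogonal to `K` ([Elgindi2021] §8.3 Proposition 8.13; [ElgindiGhoulMasmoudi2021]
§2.3.1)

Topic `Literature/Analysis/FluidPDE`. Support file (definitions with bodies and proved theorems, no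
named facts) on the proof path of the named fact
`Literature.Analysis.FluidPDE.Elgindi.ElgindiGhoulMasmoudi2021_stabilityCore`
(`ElgindiStabilityDecomposition.lean`). T. M. Elgindi, Ann. of Math. 194 (2021) =
arXiv:1904.04795, §8.3 Proposition 8.13 (p. 27); Elgindi–Ghoul–Masmoudi, arXiv:1910.14071, §2.3.1
(p. 9).

The defect of `Φ_app = a(z) sin 2θ + r(z)ψ₁(θ)` is the separable datum
`D(z,θ) = −(4α/c)·defectShape α(z)·ψ₁(θ)` (`defectDatum`; `L_αΦ_app = F_* − D`, proved where the
pieces are assembled). This file shows that `D` is an admissible datum for Elgindi's Theorem 2 in the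
`𝓗⁴`-closure class (`ElgindiTheoremTwoClosure.lean`) and is **`O(α²)` in `𝓗⁴`**:
* the radial factor has `|D_z^j(·)| ≤ C_jα²z²/(1+z)³`, hence radial energies `A_j ≤ K_jα⁴`
  (`radialEnergy_defectRadial_le`; `w²·(z²/(1+z)³)² = (1+z)^{−2}`);
* the angular factor `ψ₁` has uniformly bounded angular energies (`|ψ₁| ≤ 240 sin 2θ`,
  `|D_θ^iψ₁| ≤ C_i sin 2θ`): `∫ψ₁²s^{−c}, ∫(D_θ^iψ₁)²s^{−c} ≤ C` for `c ≤ 2`;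
* so `|D|²_{𝓗⁴} ≤ Kα⁴` (`eHkNormSq_defectDatum_le`, by the separable-product bound of
  `ElgindiL12HkBound.lean`), `gammaWords α D < ∞`, `D ∈ C^∞(strip)`;
* `ψ₁ ⊥ K` slice-wise gives `kMoment D ≡ 0` and **`L₁₂(D) ≡ 0`**: no corrector is needed in Theorem 2.
-/

noncomputable section

open Set Real Filter MeasureTheory Finset Function
open _root_.Topology
open scoped ENNReal ContDiff

namespace Literature.Analysis.FluidPDE

namespace Elgindi

/-! ### The radial factor -/

/-- **The radial factor of the defect, `−(4α/c)·defectShape α`** (`= −(L_z − μ₁)r`, `r = (4α/c)z/(1+z)²`). [cite: Elgindi2021, §8.3 Proposition 8.13 (p. 27 of arXiv:1904.04795)] -/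
def defectRadial (α z : ℝ) : ℝ := -(4 * α / profileConst α) * defectShape α z

/-- `4α/c ≤ 5α` for `0 < α ≤ 1/200` (`c ≥ 49/50`). [folklore] -/
theorem four_mul_div_profileConst_le {α : ℝ} (hα : 0 < α) (hα' : α ≤ 1 / 200) : |4 * α / profileConst α| ≤ 5 * α := by
  have hc := profileConst_ge hα.le hα'
  have hc0 : 0 < profileConst α := by linarith
  rw [abs_of_nonneg (by positivity), div_le_iff₀ hc0]
  nlinarith

/-- `defectRadial α ∈ C^∞(0, ∞)`. [folklore] -/
theorem contDiffOn_defectRadial (α : ℝ) : ContDiffOn ℝ ∞ (defectRadial α) (Ioi 0) := by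
  unfold defectRadial
  exact contDiffOn_const.mul (contDiffOn_defectShape α)

/-- **`|D_z^j defectRadial α| ≤ C_j·α²·z²/(1+z)³`** on `z > 0`, uniformly in `0 < α ≤ 1/200`. [folklore] -/
theorem abs_iterate_Dz₁_defectRadial_le (j : ℕ) :
    ∃ C : ℝ, 0 ≤ C ∧ ∀ α ∈ Ioc (0:ℝ) (1 / 200), ∀ z : ℝ, 0 < z → |(Dz₁^[j] (defectRadial α)) z| ≤ C * α ^ 2 * (z ^ 2 / (1 + z) ^ 3) := by
  obtain ⟨C, hC0, hC⟩ := abs_iterate_Dz₁_defectShape_le j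
  refine ⟨5 * C, by positivity, fun α hα z hz => ?_⟩
  have hα1 : α ∈ Icc (0:ℝ) 1 := ⟨hα.1.le, by linarith [hα.2]⟩
  have e : (Dz₁^[j] (defectRadial α)) z = -(4 * α / profileConst α) * (Dz₁^[j] (defectShape α)) z := by
    have := congrFun (iterate_Dz₁_const_mul' (-(4 * α / profileConst α)) (defectShape α) j) z
    exact this
  rw [e, abs_mul, abs_neg]
  have h1 := four_mul_div_profileConst_le hα.1 hα.2
  have h2 := hC α hα1 z hz
  have hq : 0 ≤ z ^ 2 / (1 + z) ^ 3 := by positivity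
  calc |4 * α / profileConst α| * |(Dz₁^[j] (defectShape α)) z| ≤ (5 * α) * (C * α * (z ^ 2 / (1 + z) ^ 3)) :=
        mul_le_mul h1 h2 (abs_nonneg _) (by linarith [hα.1])
    _ = 5 * C * α ^ 2 * (z ^ 2 / (1 + z) ^ 3) := by ring

/-- `∫⁻_{(0,∞)} ofReal((1+z)^{−2}) < ∞`. [folklore] -/
theorem lintegral_inv_one_add_sq_lt_top : ∫⁻ z in Ioi (0:ℝ), ENNReal.ofReal (1 / (1 + z) ^ 2) < ⊤ :=
  lintegral_Ioi_const_div_one_add_sq_lt_top zero_le_one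

/-- **The radial energies of the defect factor are `O(α⁴)`**: `A_j(defectRadial α) ≤ K_jα⁴`. [folklore] -/
theorem radialEnergy_defectRadial_le (j : ℕ) :
    ∃ K : ℝ, 0 ≤ K ∧ ∀ α ∈ Ioc (0:ℝ) (1 / 200), radialEnergy j (defectRadial α) ≤ ENNReal.ofReal (K * α ^ 4) := by
  obtain ⟨C, hC0, hC⟩ := abs_iterate_Dz₁_defectRadial_le j
  set I₀ : ℝ≥0∞ := ∫⁻ z in Ioi (0:ℝ), ENNReal.ofReal (1 / (1 + z) ^ 2) with hI₀
  have hI₀ : I₀ ≠ ⊤ := lintegral_inv_one_add_sq_lt_top.ne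
  refine ⟨C ^ 2 * I₀.toReal, by positivity, fun α hα => ?_⟩
  have hpt : ∀ z ∈ Ioi (0:ℝ), ENNReal.ofReal (radialWeight z ^ 2 * (Dz₁^[j] (defectRadial α)) z ^ 2) ≤
      ENNReal.ofReal (C ^ 2 * α ^ 4) * ENNReal.ofReal (1 / (1 + z) ^ 2) := by
    intro z hz
    have hz' : (0:ℝ) < z := hz
    rw [← ENNReal.ofReal_mul (by positivity)]
    refine ENNReal.ofReal_le_ofReal ?_
    have hb := hC α hα z hz'
    have hsq : (Dz₁^[j] (defectRadial α)) z ^ 2 ≤ (C * α ^ 2 * (z ^ 2 / (1 + z) ^ 3)) ^ 2 := by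
      rw [← sq_abs]; exact pow_le_pow_left₀ (abs_nonneg _) hb 2
    have hw : radialWeight z ^ 2 = (1 + z) ^ 4 / z ^ 4 := by unfold radialWeight; field_simp
    have hz1 : (0:ℝ) < 1 + z := by linarith
    calc radialWeight z ^ 2 * (Dz₁^[j] (defectRadial α)) z ^ 2 ≤ radialWeight z ^ 2 * (C * α ^ 2 * (z ^ 2 / (1 + z) ^ 3)) ^ 2 :=
          mul_le_mul_of_nonneg_left hsq (sq_nonneg _)
      _ = C ^ 2 * α ^ 4 * (1 / (1 + z) ^ 2) := by rw [hw]; field_simp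
  calc radialEnergy j (defectRadial α) ≤ ∫⁻ z in Ioi (0:ℝ), ENNReal.ofReal (C ^ 2 * α ^ 4) * ENNReal.ofReal (1 / (1 + z) ^ 2) :=
        setLIntegral_mono' measurableSet_Ioi hpt
    _ = ENNReal.ofReal (C ^ 2 * α ^ 4) * I₀ := by rw [lintegral_const_mul' _ _ ENNReal.ofReal_ne_top]
    _ = ENNReal.ofReal (C ^ 2 * α ^ 4) * ENNReal.ofReal I₀.toReal := by rw [ENNReal.ofReal_toReal hI₀]
    _ = ENNReal.ofReal (C ^ 2 * I₀.toReal * α ^ 4) := by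
        rw [← ENNReal.ofReal_mul (by positivity)]
        congr 1; ring

/-! ### The angular energies of `ψ₁` -/

section angular

variable {α : ℝ} (hα : 0 < α) (hα' : α ≤ 1 / 200)
include hα hα'

/-- **`∫₀^{π/2} ψ₁² sin(2θ)^{−c} ≤ 240²·(π/2)`** for `c ≤ 2` (`|ψ₁| ≤ 240 sin 2θ`). [folklore] -/
theorem lintegral_psiOne_sq_mul_rpow_le {c : ℝ} (hc : c ≤ 2) :
    ∫⁻ θ in Ioo 0 (π / 2), ENNReal.ofReal (psiOne α θ ^ 2 * Real.sin (2 * θ) ^ (-c)) ≤ ENNReal.ofReal (240 ^ 2 * (π / 2)) := by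
  have hpt : ∀ θ ∈ Ioo (0:ℝ) (π / 2), ENNReal.ofReal (psiOne α θ ^ 2 * Real.sin (2 * θ) ^ (-c)) ≤ ENNReal.ofReal (240 ^ 2) := by
    intro θ hθ
    refine ENNReal.ofReal_le_ofReal ?_
    have h1 := abs_psiOne_le_sin_two_mul hα hα' hθ
    have hs : 0 < Real.sin (2 * θ) := Real.sin_pos_of_pos_of_lt_pi (by linarith [hθ.1]) (by linarith [hθ.2])
    have hrc : 0 ≤ Real.sin (2 * θ) ^ (-c) := Real.rpow_nonneg hs.le _
    have h2 : psiOne α θ ^ 2 ≤ 240 ^ 2 * Real.sin (2 * θ) ^ 2 := by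
      rw [← sq_abs, ← mul_pow]; exact pow_le_pow_left₀ (abs_nonneg _) h1 2
    have h3 := sin2_sq_mul_rpow_neg_le hc hθ
    calc psiOne α θ ^ 2 * Real.sin (2 * θ) ^ (-c) ≤ 240 ^ 2 * Real.sin (2 * θ) ^ 2 * Real.sin (2 * θ) ^ (-c) :=
          mul_le_mul_of_nonneg_right h2 hrc
      _ = 240 ^ 2 * (Real.sin (2 * θ) ^ 2 * Real.sin (2 * θ) ^ (-c)) := by ring
      _ ≤ 240 ^ 2 * 1 := mul_le_mul_of_nonneg_left h3 (by positivity)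
      _ = 240 ^ 2 := by ring
  calc ∫⁻ θ in Ioo 0 (π / 2), ENNReal.ofReal (psiOne α θ ^ 2 * Real.sin (2 * θ) ^ (-c))
      ≤ ∫⁻ _θ in Ioo 0 (π / 2), ENNReal.ofReal (240 ^ 2) := setLIntegral_mono' measurableSet_Ioo hpt
    _ = ENNReal.ofReal (240 ^ 2 * (π / 2)) := by
        rw [setLIntegral_const, Real.volume_Ioo, sub_zero, ← ENNReal.ofReal_mul (by positivity)]

end angular

/-- **`∫₀^{π/2} (D_θ^{i+1}ψ₁)² sin(2θ)^{−c} ≤ C_i`** for `c ≤ 2`, uniformly in `0 < α ≤ 1/200`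
(`|D_θ^{i+1}ψ₁| ≤ C_i sin 2θ`). [folklore] -/
theorem exists_lintegral_iterate_Dθ₁_psiOne_sq_le (i : ℕ) :
    ∃ C : ℝ, 0 ≤ C ∧ ∀ α ∈ Ioc (0:ℝ) (1 / 200), ∀ c : ℝ, c ≤ 2 →
      ∫⁻ θ in Ioo 0 (π / 2), ENNReal.ofReal ((Dθ₁^[i + 1] (psiOne α)) θ ^ 2 * Real.sin (2 * θ) ^ (-c)) ≤ ENNReal.ofReal C := by
  obtain ⟨C, hC0, hC⟩ := abs_iterate_Dθ₁_psiOne_le i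
  refine ⟨C ^ 2 * (π / 2), by positivity, fun α hα c hc => ?_⟩
  have hpt : ∀ θ ∈ Ioo (0:ℝ) (π / 2), ENNReal.ofReal ((Dθ₁^[i + 1] (psiOne α)) θ ^ 2 * Real.sin (2 * θ) ^ (-c)) ≤ ENNReal.ofReal (C ^ 2) := by
    intro θ hθ
    refine ENNReal.ofReal_le_ofReal ?_
    have h1 := hC α hα.1 hα.2 θ hθ
    have hs : 0 < Real.sin (2 * θ) := Real.sin_pos_of_pos_of_lt_pi (by linarith [hθ.1]) (by linarith [hθ.2])
    have hrc : 0 ≤ Real.sin (2 * θ) ^ (-c) := Real.rpow_nonneg hs.le _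
    have h2 : (Dθ₁^[i + 1] (psiOne α)) θ ^ 2 ≤ C ^ 2 * Real.sin (2 * θ) ^ 2 := by
      rw [← sq_abs, ← mul_pow]; exact pow_le_pow_left₀ (abs_nonneg _) h1 2
    have h3 := sin2_sq_mul_rpow_neg_le hc hθ
    calc (Dθ₁^[i + 1] (psiOne α)) θ ^ 2 * Real.sin (2 * θ) ^ (-c) ≤ C ^ 2 * Real.sin (2 * θ) ^ 2 * Real.sin (2 * θ) ^ (-c) :=
          mul_le_mul_of_nonneg_right h2 hrc
      _ = C ^ 2 * (Real.sin (2 * θ) ^ 2 * Real.sin (2 * θ) ^ (-c)) := by ring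
      _ ≤ C ^ 2 * 1 := mul_le_mul_of_nonneg_left h3 (by positivity)
      _ = C ^ 2 := by ring
  calc ∫⁻ θ in Ioo 0 (π / 2), ENNReal.ofReal ((Dθ₁^[i + 1] (psiOne α)) θ ^ 2 * Real.sin (2 * θ) ^ (-c))
      ≤ ∫⁻ _θ in Ioo 0 (π / 2), ENNReal.ofReal (C ^ 2) := setLIntegral_mono' measurableSet_Ioo hpt
    _ = ENNReal.ofReal (C ^ 2 * (π / 2)) := by
        rw [setLIntegral_const, Real.volume_Ioo, sub_zero, ← ENNReal.ofReal_mul (by positivity)]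

/-- **A common bound for the angular energies of `ψ₁` entering the separable-product estimate.** [folklore] -/
theorem exists_angularEnergy_psiOne_le :
    ∃ C : ℝ, 0 ≤ C ∧ ∀ α ∈ Ioc (0:ℝ) (1 / 200),
      (∫⁻ θ in Ioo 0 (π / 2), ENNReal.ofReal (psiOne α θ ^ 2 * Real.sin (2 * θ) ^ (-eta)) ≤ ENNReal.ofReal C) ∧
      ∀ i : ℕ, 1 ≤ i → i ≤ 4 →
        ∫⁻ θ in Ioo 0 (π / 2), ENNReal.ofReal ((Dθ₁^[i] (psiOne α)) θ ^ 2 * Real.sin (2 * θ) ^ (-gammaExp α)) ≤ ENNReal.ofReal C := by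
  obtain ⟨C₁, h₁, b₁⟩ := exists_lintegral_iterate_Dθ₁_psiOne_sq_le 0
  obtain ⟨C₂, h₂, b₂⟩ := exists_lintegral_iterate_Dθ₁_psiOne_sq_le 1
  obtain ⟨C₃, h₃, b₃⟩ := exists_lintegral_iterate_Dθ₁_psiOne_sq_le 2
  obtain ⟨C₄, h₄, b₄⟩ := exists_lintegral_iterate_Dθ₁_psiOne_sq_le 3
  set C₀ : ℝ := 240 ^ 2 * (π / 2) with hC₀
  have hC₀0 : 0 ≤ C₀ := by positivity
  refine ⟨C₀ + C₁ + C₂ + C₃ + C₄, by positivity, fun α hα => ⟨?_, fun i hi1 hi4 => ?_⟩⟩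
  · exact (lintegral_psiOne_sq_mul_rpow_le hα.1 hα.2 (by unfold eta; norm_num)).trans (ENNReal.ofReal_le_ofReal (by linarith))
  · have hγ : gammaExp α ≤ 2 := by unfold gammaExp; linarith [hα.2]
    interval_cases i
    · exact (b₁ α hα _ hγ).trans (ENNReal.ofReal_le_ofReal (by linarith))
    · exact (b₂ α hα _ hγ).trans (ENNReal.ofReal_le_ofReal (by linarith))
    · exact (b₃ α hα _ hγ).trans (ENNReal.ofReal_le_ofReal (by linarith))
    · exact (b₄ α hα _ hγ).trans (ENNReal.ofReal_le_ofReal (by linarith))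

/-! ### The defect datum -/

/-- **The defect datum `D = defectRadial α ⊗ ψ₁`** of the approximate stream function of `Φ_*`. [cite: Elgindi2021, §8.3 Proposition 8.13 (p. 27 of arXiv:1904.04795); ElgindiGhoulMasmoudi2021, §2.3.1 (p. 9 of arXiv:1910.14071)] -/
def defectDatum (α : ℝ) : ℝ → ℝ → ℝ := tensor (defectRadial α) (psiOne α)

section datum

variable {α : ℝ} (hα : 0 < α) (hα' : α ≤ 1 / 200)
include hα hα'

/-- **`D ∈ C^∞(strip)`.** [folklore] -/
theorem contDiffOn_defectDatum : ContDiffOn ℝ ∞ (uncurry (defectDatum α)) strip :=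
  contDiffOn_tensor (contDiffOn_defectRadial α) (contDiffOn_psiOne hα hα')

/-- **`ψ₁ ⊥ K`** as a set integral: `∫_{(0,π/2)} ψ₁K = 0`. [folklore] -/
theorem setIntegral_psiOne_mul_kernelK : ∫ θ in Ioo 0 (π / 2), psiOne α θ * kernelK θ = 0 := by
  have h := integral_psiOne_mul_K0 hα hα'
  rw [intervalIntegral.integral_of_le (by positivity), integral_Ioc_eq_integral_Ioo] at h
  have e : (fun θ => psiOne α θ * kernelK θ) = fun θ => 3 * (psiOne α θ * (Real.sin θ * Real.cos θ ^ 2)) := by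
    funext θ; simp only [kernelK]; ring
  rw [e, integral_const_mul, h, mul_zero]

/-- **`kMoment D ≡ 0`**: the defect datum is orthogonal to `K` slice-wise. [cite: Elgindi2021, §8.3 (p. 27 of arXiv:1904.04795): "so that ∫₀^{π/2} F̄_* K = 0"] -/
theorem kMoment_defectDatum (z : ℝ) : kMoment (defectDatum α) z = 0 := by
  rw [kMoment_def]
  have e : (fun θ => defectDatum α z θ * kernelK θ) = fun θ => defectRadial α z * (psiOne α θ * kernelK θ) := by
    funext θ; simp only [defectDatum, tensor_apply]; ring
  rw [e, integral_const_mul, setIntegral_psiOne_mul_kernelK hα hα', mul_zero]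

/-- **`L₁₂(D) ≡ 0`.** [folklore] -/
theorem L12_defectDatum (z : ℝ) : L12 (defectDatum α) z = 0 := by
  rw [L12_def]
  have e : ∀ r : ℝ, (∫ θ in Ioo 0 (π / 2), defectDatum α r θ * kernelK θ / r) = 0 := by
    intro r
    have e1 : (fun θ => defectDatum α r θ * kernelK θ / r) = fun θ => (defectRadial α r / r) * (psiOne α θ * kernelK θ) := by
      funext θ; simp only [defectDatum, tensor_apply]; ring
    rw [e1, integral_const_mul, setIntegral_psiOne_mul_kernelK hα hα', mul_zero]
  simp_rw [e]
  simp

omit hα hα' in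
/-- **The defect datum is `O(α²)` in `𝓗⁴`**: `|D|²_{𝓗⁴} ≤ Kα⁴`, uniformly in `0 < α ≤ 1/200`. [cite: Elgindi2021, §8.3 Proposition 8.13 (p. 27 of arXiv:1904.04795): the remainder of Φ_* beyond (1/4α)sin(2θ)L₁₂(F_*) is O(α)] -/
theorem eHkNormSq_defectDatum_le :
    ∃ K : ℝ, 0 ≤ K ∧ ∀ α ∈ Ioc (0:ℝ) (1 / 200), eHkNormSq α 4 (defectDatum α) ≤ ENNReal.ofReal (K * α ^ 4) := by
  obtain ⟨Ca, hCa, hang⟩ := exists_angularEnergy_psiOne_le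
  obtain ⟨K₀, hK₀, r₀⟩ := radialEnergy_defectRadial_le 0
  obtain ⟨K₁, hK₁, r₁⟩ := radialEnergy_defectRadial_le 1
  obtain ⟨K₂, hK₂, r₂⟩ := radialEnergy_defectRadial_le 2
  obtain ⟨K₃, hK₃, r₃⟩ := radialEnergy_defectRadial_le 3
  obtain ⟨K₄, hK₄, r₄⟩ := radialEnergy_defectRadial_le 4
  refine ⟨30 * (Ca * (K₀ + K₁ + K₂ + K₃ + K₄)), by positivity, fun α hα => ?_⟩
  obtain ⟨h0, hi⟩ := hang α hα
  have hg : ContDiffOn ℝ 4 (defectRadial α) (Ioi 0) := contDiffOn_infty.1 (contDiffOn_defectRadial α) 4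
  have ha : ContDiffOn ℝ 4 (psiOne α) (Ioo 0 (π / 2)) := contDiffOn_infty.1 (contDiffOn_psiOne hα.1 hα.2) 4
  have h := eHkNormSq_tensor_le_of_angular α hg ha (C := ENNReal.ofReal Ca) h0 hi
  have hsum : ∑ j ∈ range 5, radialEnergy j (defectRadial α) ≤ ENNReal.ofReal ((K₀ + K₁ + K₂ + K₃ + K₄) * α ^ 4) := by
    rw [Finset.sum_range_succ, Finset.sum_range_succ, Finset.sum_range_succ, Finset.sum_range_succ, Finset.sum_range_one]
    calc radialEnergy 0 (defectRadial α) + radialEnergy 1 (defectRadial α) + radialEnergy 2 (defectRadial α) + radialEnergy 3 (defectRadial α) + radialEnergy 4 (defectRadial α)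
        ≤ ENNReal.ofReal (K₀ * α ^ 4) + ENNReal.ofReal (K₁ * α ^ 4) + ENNReal.ofReal (K₂ * α ^ 4) + ENNReal.ofReal (K₃ * α ^ 4) + ENNReal.ofReal (K₄ * α ^ 4) :=
          add_le_add (add_le_add (add_le_add (add_le_add (r₀ α hα) (r₁ α hα)) (r₂ α hα)) (r₃ α hα)) (r₄ α hα)
      _ = ENNReal.ofReal ((K₀ + K₁ + K₂ + K₃ + K₄) * α ^ 4) := by
          have hα4 : 0 ≤ α ^ 4 := by positivity
          rw [← ENNReal.ofReal_add (by positivity) (by positivity), ← ENNReal.ofReal_add (by positivity) (by positivity),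
            ← ENNReal.ofReal_add (by positivity) (by positivity), ← ENNReal.ofReal_add (by positivity) (by positivity)]
          congr 1; ring
  unfold defectDatum
  calc eHkNormSq α 4 (tensor (defectRadial α) (psiOne α)) ≤ 30 * (ENNReal.ofReal Ca * ∑ j ∈ range 5, radialEnergy j (defectRadial α)) := h
    _ ≤ 30 * (ENNReal.ofReal Ca * ENNReal.ofReal ((K₀ + K₁ + K₂ + K₃ + K₄) * α ^ 4)) := by gcongr
    _ = ENNReal.ofReal (30 * (Ca * (K₀ + K₁ + K₂ + K₃ + K₄)) * α ^ 4) := by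
        rw [← ENNReal.ofReal_mul hCa, ← ENNReal.ofReal_ofNat 30, ← ENNReal.ofReal_mul (by norm_num)]
        congr 1; ring

/-- **`gammaWords α D < ∞`**: the defect datum lies in the `𝓗⁴`-closure class. [folklore] -/
theorem gammaWords_defectDatum_lt_top : gammaWords α (defectDatum α) < ⊤ := by
  unfold gammaWords defectDatum
  refine ENNReal.sum_lt_top.2 fun j hj => ?_
  have hj4 : j ≤ 4 := by have := Finset.mem_range.1 hj; omega
  have hg : ContDiffOn ℝ 4 (defectRadial α) (Ioi 0) := contDiffOn_infty.1 (contDiffOn_defectRadial α) 4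
  have ha : ContDiffOn ℝ 4 (psiOne α) (Ioo 0 (π / 2)) := contDiffOn_infty.1 (contDiffOn_psiOne hα hα') 4
  have e : ∀ p ∈ strip, ENNReal.ofReal (radialWeight p.1 ^ 2 * (Dz^[j] (tensor (defectRadial α) (psiOne α))) p.1 p.2 ^ 2 * Real.sin (2 * p.2) ^ (-gammaExp α)) =
      ENNReal.ofReal (radialWeight p.1 ^ 2 * ((Dz₁^[j] (defectRadial α)) p.1 * (Dθ₁^[0] (psiOne α)) p.2) ^ 2 * Real.sin (2 * p.2) ^ (-gammaExp α)) := by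
    intro p _
    rw [iterate_Dz_tensor]
    simp only [tensor_apply, Function.iterate_zero, id_eq]
  rw [setLIntegral_congr_fun measurableSet_strip e, lintegral_word_tensor_eq hg ha (by norm_num) hj4]
  obtain ⟨K, -, hK⟩ := radialEnergy_defectRadial_le j
  have h1 : radialEnergy j (defectRadial α) < ⊤ := lt_of_le_of_lt (hK α ⟨hα, hα'⟩) ENNReal.ofReal_lt_top
  have hγ : gammaExp α ≤ 2 := by unfold gammaExp; linarith
  have h2 : ∫⁻ θ in Ioo 0 (π / 2), ENNReal.ofReal ((Dθ₁^[0] (psiOne α)) θ ^ 2 * Real.sin (2 * θ) ^ (-gammaExp α)) < ⊤ := by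
    simp only [Function.iterate_zero, id_eq]
    exact lt_of_le_of_lt (lintegral_psiOne_sq_mul_rpow_le hα hα' hγ) ENNReal.ofReal_lt_top
  exact ENNReal.mul_lt_top h1 h2

/-- `|D|²_{𝓗⁴} < ∞`. [folklore] -/
theorem eHkNormSq_defectDatum_lt_top : eHkNormSq α 4 (defectDatum α) < ⊤ := by
  obtain ⟨K, -, hK⟩ := eHkNormSq_defectDatum_le
  exact lt_of_le_of_lt (hK α ⟨hα, hα'⟩) ENNReal.ofReal_lt_top

end datum

end Elgindi

end Literature.Analysis.FluidPDE
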